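import Mathlib.RingTheory.Polynomial.Basic
import Mathlib.Algebra.Polynomial.Expand
import Mathlib.Algebra.Polynomial.Div
import Mathlib.Algebra.CharP.Lemmas
import Mathlib.RingTheory.Ideal.Quotient.Operations
import Literature.RingTheory.TightClosure.TightClosure
import HarnessLib

/-!
# Frobenius closure descends through division by a monic polynomial
# (crux `FInjectiveMacaulayfication` stmt-ResolutionOfSingularities-15315, chain w45a; R11.11 cylinder producer, step S1;
# owner res-D-pv-017 AS res-L1-w45a-stub-5)

Support file for crux stmt-ResolutionOfSingularities-15315 (`FrobeniusLadder.FInjectiveMacaulayfication`), chain w45a.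
[OURS · L1 W4.5a] — NOT a statement of any manuscript; AI-written, weaker than expert review.

The polynomial heart of «the Cohen–Macaulay + F-injective clause ascends along `A → A[t]_P`» (S1
`PolynomialLocalizationClause.clause_polynomial_localization`): let `𝔵 ⊆ A` be an ideal whose `q`-th Frobenius power detects
membership (`a^q ∈ 𝔵^[q] ⇒ a ∈ 𝔵`, `q = p^e`), and `g ∈ A[t]` MONIC of positive degree. If `f ∈ A[t]` has
`f^q ∈ 𝔵^[q]·A[t] + (g^q)`, then `f ∈ 𝔵·A[t] + (g)` (`mem_sup_span_of_pow_mem`). Proof: divide `f = g·s + r`, `deg r < deg g`; in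
characteristic `p`, `r^q = f^q − g^q s^q ∈ 𝔵^[q]A[t] + (g^q)`, so `r^q ≡ c·g^q (mod 𝔵^[q])`; over `A/𝔵^[q]` the right side is `0` or
has degree `≥ q·deg g > deg r^q`, hence `c ≡ 0` and every coefficient of `r^q` — i.e. every `(r_i)^q` — lies in `𝔵^[q]`, so
`r ∈ 𝔵·A[t]`. Also: a monic `g` is a non-zero-divisor modulo `𝔵·A[t]` (`mem_map_C_of_monic_mul_mem`). No separability of `ḡ` is
involved. No definitions, no named facts. [folklore]
-/

-- single-problem summit: the doubled namespace component is forced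
set_option linter.dupNamespace false

noncomputable section

open Polynomial Literature.RingTheory.TightClosure

namespace Summit.ResolutionOfSingularities.ResolutionOfSingularities.Theorems.FInjectiveMacaulayfication.PolynomialLocalizationClause

/-- In characteristic `p`, the coefficient of `t^{i q}` in `r^q` is `(r_i)^q` (`q = p^e`). [folklore] -/
theorem coeff_pow_char_pow_mul (p : ℕ) [Fact p.Prime] {A : Type*} [CommRing A] [CharP A p] (r : A[X]) (e i : ℕ) :
    (r ^ p ^ e).coeff (i * p ^ e) = r.coeff i ^ p ^ e := by
  haveI : ExpChar A p := ExpChar.prime Fact.out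
  rw [← map_iterateFrobenius_expand p r e, coeff_map, coeff_expand_mul (pow_pos (Fact.out : p.Prime).pos e),
    iterateFrobenius_def]

/-- A polynomial all of whose coefficients of `f^q` lie in `𝔵^[q]` has all its coefficients' `q`-th powers in `𝔵^[q]`; if
`𝔵^[q]` detects membership in `𝔵`, then `f ∈ 𝔵·A[t]`. [folklore] -/
theorem mem_map_C_of_pow_mem_map_C (p : ℕ) [Fact p.Prime] {A : Type*} [CommRing A] [CharP A p] (𝔵 : Ideal A) (e : ℕ)
    (h𝔵 : ∀ a : A, a ^ p ^ e ∈ frobeniusPower (p ^ e) 𝔵 → a ∈ 𝔵) {r : A[X]}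
    (hr : r ^ p ^ e ∈ (frobeniusPower (p ^ e) 𝔵).map (C : A →+* A[X])) :
    r ∈ 𝔵.map (C : A →+* A[X]) := by
  rw [Ideal.mem_map_C_iff]
  intro i
  apply h𝔵
  rw [← coeff_pow_char_pow_mul p r e i]
  exact Ideal.mem_map_C_iff.mp hr _

/-- **A monic polynomial is a non-zero-divisor modulo `𝔵·A[t]`**: `g` monic and `g·f ∈ 𝔵·A[t]` imply `f ∈ 𝔵·A[t]` (reduce
modulo `𝔵`: `ḡ` is monic, hence regular, in `(A/𝔵)[t]`). [folklore] -/
theorem mem_map_C_of_monic_mul_mem {A : Type*} [CommRing A] (𝔵 : Ideal A) {g : A[X]} (hg : g.Monic) {f : A[X]}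
    (h : g * f ∈ 𝔵.map (C : A →+* A[X])) : f ∈ 𝔵.map (C : A →+* A[X]) := by
  have hker : ∀ h : A[X], h ∈ 𝔵.map (C : A →+* A[X]) ↔ h.map (Ideal.Quotient.mk 𝔵) = 0 := by
    intro h
    rw [Ideal.mem_map_C_iff, Polynomial.ext_iff]
    simp only [coeff_map, coeff_zero, Ideal.Quotient.eq_zero_iff_mem]
  rw [hker] at h ⊢
  rw [Polynomial.map_mul] at h
  exact (hg.map (Ideal.Quotient.mk 𝔵)).isRegular.left (h.trans (mul_zero _).symm)

/-- **Frobenius closure descends through division by a monic polynomial.** `𝔵 ⊆ A` with `a^q ∈ 𝔵^[q] ⇒ a ∈ 𝔵` (`q = p^e`),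
`g` monic of positive degree, `f^q ∈ 𝔵^[q]·A[t] + (g^q)` ⟹ `f ∈ 𝔵·A[t] + (g)`. See the module docstring for the proof.
[folklore] -/
theorem mem_sup_span_of_pow_mem (p : ℕ) [Fact p.Prime] {A : Type*} [CommRing A] [CharP A p] (𝔵 : Ideal A) (e : ℕ)
    (h𝔵 : ∀ a : A, a ^ p ^ e ∈ frobeniusPower (p ^ e) 𝔵 → a ∈ 𝔵)
    {g : A[X]} (hg : g.Monic) (hg1 : 0 < g.natDegree) {f : A[X]}
    (hf : f ^ p ^ e ∈ (frobeniusPower (p ^ e) 𝔵).map (C : A →+* A[X]) ⊔ Ideal.span {g ^ p ^ e}) :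
    f ∈ 𝔵.map (C : A →+* A[X]) ⊔ Ideal.span {g} := by
  set q : ℕ := p ^ e with hq
  have hq1 : 1 ≤ q := Nat.one_le_pow _ _ (Fact.out : p.Prime).pos
  -- division with remainder
  set r := f %ₘ g with hr
  set s := f /ₘ g with hs
  have hfrs : f = r + g * s := (modByMonic_add_div f g).symm
  have hgq : g ^ q * s ^ q ∈ (frobeniusPower q 𝔵).map (C : A →+* A[X]) ⊔ Ideal.span {g ^ q} :=
    Ideal.mem_sup_right (Ideal.mul_mem_right _ _ (Ideal.mem_span_singleton_self _))
  have hrq : r ^ q ∈ (frobeniusPower q 𝔵).map (C : A →+* A[X]) ⊔ Ideal.span {g ^ q} := by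
    have : r ^ q = f ^ q - g ^ q * s ^ q := by
      rw [hfrs, hq, add_pow_char_pow, mul_pow]; ring
    rw [this]
    exact Ideal.sub_mem _ hf hgq
  -- `r^q = j + c g^q` with `j ∈ 𝔵^[q] A[t]`
  obtain ⟨j, hj, c', hc', hsum⟩ := Submodule.mem_sup.mp hrq
  obtain ⟨c, rfl⟩ := Ideal.mem_span_singleton'.mp hc'
  -- reduce modulo `𝔵^[q]`
  set π := Ideal.Quotient.mk (frobeniusPower q 𝔵) with hπ
  have hker : ∀ h : A[X], h ∈ (frobeniusPower q 𝔵).map (C : A →+* A[X]) ↔ h.map π = 0 := by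
    intro h
    rw [Ideal.mem_map_C_iff, Polynomial.ext_iff]
    simp only [coeff_map, coeff_zero, hπ, Ideal.Quotient.eq_zero_iff_mem]
  have hj0 : j.map π = 0 := (hker j).mp hj
  have hbar : (r.map π) ^ q = c.map π * (g.map π) ^ q := by
    rw [← Polynomial.map_pow, ← hsum, Polynomial.map_add, hj0, zero_add, Polynomial.map_mul, Polynomial.map_pow]
  -- degree count: `c̄ = 0`
  have hgπ : (g.map π ^ q).Monic := (hg.map π).pow q
  have hc0 : c.map π = 0 := by
    by_contra hc
    haveI : Nontrivial (A ⧸ frobeniusPower q 𝔵) := by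
      by_contra hnt
      rw [not_nontrivial_iff_subsingleton] at hnt
      exact hc (Subsingleton.elim _ _)
    have hrdeg : (r.map π).natDegree < g.natDegree :=
      lt_of_le_of_lt natDegree_map_le (natDegree_modByMonic_lt f hg fun h1 => by
        rw [h1, natDegree_one] at hg1; exact lt_irrefl 0 hg1)
    have hdeg1 : ((r.map π) ^ q).natDegree < q * g.natDegree :=
      lt_of_le_of_lt natDegree_pow_le ((Nat.mul_lt_mul_left (by omega)).mpr hrdeg)
    have hdeg2 : q * g.natDegree ≤ (c.map π * (g.map π) ^ q).natDegree := by
      rw [mul_comm (c.map π), hgπ.natDegree_mul' hc, (hg.map π).natDegree_pow, hg.natDegree_map]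
      exact Nat.le_add_right _ _
    rw [← hbar] at hdeg2
    exact absurd (lt_of_le_of_lt hdeg2 hdeg1) (lt_irrefl _)
  have hrq0 : r ^ q ∈ (frobeniusPower q 𝔵).map (C : A →+* A[X]) := by
    rw [hker, Polynomial.map_pow, hbar, hc0, zero_mul]
  -- coefficientwise descent
  have hr𝔵 : r ∈ 𝔵.map (C : A →+* A[X]) := mem_map_C_of_pow_mem_map_C p 𝔵 e h𝔵 hrq0
  rw [hfrs]
  exact Submodule.add_mem_sup hr𝔵 (Ideal.mul_mem_right _ _ (Ideal.mem_span_singleton_self g))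

end Summit.ResolutionOfSingularities.ResolutionOfSingularities.Theorems.FInjectiveMacaulayfication.PolynomialLocalizationClause

end
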